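import Summits.CriticalPhenomena.PercolationContinuityZ3.Theorems.PercNearOneGluingNoHeavyQuantFarGate3BoxCertE
import HarnessLib

/-!
# QUANT lane R8, front "FAR beyond trees", layer one — THE DEGREE-THREE GATE AT THE OBSERVER, XLIVd: box-certificate kernel IIId — SOUNDNESS `BoxCert.sound`

builds on p205010 (kernel theorem, internal audit signed; external expert review pending)

Support file (`--supports stmt-CriticalPhenomena-4575`), seat `prim-quant-p1` (gen 31); memo
`run/shared/lean/prim/quant/prim-quant-p1-g31/FOR-LEAD-GATE3-BOXES.md`.  Mathlib-only + earlier files of the box-certificate kernel; standard axioms;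
no sorries.  GENERATED by `work/lean/gen_boxcert.py` (one generator, four files XLIVa–d).

`BoxCert.sound`: `check d = true` ⟹ the 8-cell statement (`hred8`, hypothesis `h8` of `Gate3.red_of_red8`) at every `(p, r₁, r₂)` of the box
(`0 < p`, `0 ≤ r₁ ≤ r₂ < 1`) and every real `nn` in the window — via `eval_nonpos_of_ctrl` (XLII), `eval_polyOf` (XLIVc), `cert8u` (XLIVa) and
`Gate3.red8_of_red8i` (XLI).
[this work].
-/

namespace Summit.CriticalPhenomena.PercolationContinuityZ3.Theorems

namespace Quant

namespace BoxCert

open BoxPoly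

/-! ## Soundness -/

/-- **Soundness of the checker.**  A checked certificate proves the 8-cell statement at every parameter point of its box (with `r₁ ≤ r₂ < 1`,
`0 < p`) and every `nn` of its window. -/
theorem sound (d : Cert) (hchk : check d = true) (p r₁ r₂ nn : ℝ) (hp : 0 < p) (hr12 : r₁ ≤ r₂) (hr2 : r₂ < 1) (hr10 : 0 ≤ r₁)
    (hP0 : (d.P0 : ℝ) ≤ d.D * p) (hP1 : (d.D : ℝ) * p ≤ d.P1)
    (hU0 : (d.U0 : ℝ) ≤ d.D * (1 - r₁)) (hU1 : (d.D : ℝ) * (1 - r₁) ≤ d.U1)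
    (hV0 : (d.V0 : ℝ) ≤ d.D * (1 - r₂)) (hV1 : (d.D : ℝ) * (1 - r₂) ≤ d.V1)
    (hwS : d.sfree = true ∨ (d.SS : ℝ) + d.SS1 * p ≤ d.D * p * nn) (hwE : d.efree = true ∨ (d.D : ℝ) * p * nn ≤ d.SE + d.SE1 * p) :
    ∀ (a0 a1 a2 b1 b2 c0 c1 d : ℝ), 0 ≤ a0 → 0 ≤ a1 → 0 ≤ a2 → 0 ≤ b1 → 0 ≤ b2 → 0 ≤ c0 → 0 ≤ c1 → 0 ≤ d →
        b1 * (b2 + (c0 + c1)) ≤ (a0 + a1 + a2) * d →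
        b2 * (b1 + (c0 + c1)) ≤ (a0 + a1 + a2) * d →
        (c0 + c1) * (b1 + b2) ≤ (a0 + a1 + a2) * d →
        b1 * (a1 + a2 + c1 + d) ≤ d * (a0 + b1 + b2 + c0) →
        b2 * (a1 + a2 + c1 + d) ≤ d * (a0 + b1 + b2 + c0) →
        c0 * (a1 + a2 + c1 + d) ≤ (c1 + d) * (a0 + b1 + b2 + c0) →
        0 < p * ((1 - r₁) * (1 - r₂)) * (a0 + c0) - (1 - p) * a2 - (1 - p) * ((1 - r₁) * (1 - r₂)) * d →
        0 < (1 - p) * (1 - r₁) * b1 - p * (r₂ * (1 - r₁)) * a0 - p * (1 - r₁) * a1 - (1 - p * r₁) * a2 - (1 - (1 - p) * (1 - r₂)) * (1 - r₁) * b2 - p * ((1 - r₁) * (1 - r₂)) * c1 →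
        0 < (1 - p) * (1 - r₂) * b2 - p * (r₁ * (1 - r₂)) * a0 - p * (1 - r₂) * a1 - (1 - p * r₂) * a2 - (1 - (1 - p) * (1 - r₁)) * (1 - r₂) * b1 - p * ((1 - r₁) * (1 - r₂)) * c1 →
        0 < (1 - p * max r₁ r₂ - nn * p * (1 - max r₁ r₂)) * a1 + (1 - p * (r₁ + r₂ * (1 - r₁)) - nn * p * ((1 - r₁) * (1 - r₂))) * c1 - nn * p * (r₁ + r₂ * (1 - r₁) - max r₁ r₂) * a0 - nn * ((1 - (1 - p) * (1 - r₁)) * (1 - r₂)) * b1 - nn * ((1 - (1 - p) * (1 - r₂)) * (1 - r₁)) * b2 →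
        0 < (p * (1 + r₁ + r₂ + nn * max r₁ r₂) - 2) * a0 + (p * (1 + r₁ + r₂) + p * max r₁ r₂ * (nn - 1) - 1) * a1 + (p * (1 + r₁ + r₂) + nn - 2) * a2 + ((1 - (1 - p) * (1 - r₁)) * (1 + r₂ * (nn + 1)) - 1) * b1 + ((1 - (1 - p) * (1 - r₂)) * (1 + r₁ * (nn + 1)) - 1) * b2 + (p * (1 + (nn + 2) * (r₁ + r₂ * (1 - r₁))) - 2) * c0 + (p * (1 + (nn + 1) * (r₁ + r₂ * (1 - r₁))) - 1) * c1 + (nn + 1 - (1 - p) * ((1 - r₁) * (1 - r₂))) * d →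
        False := by
  -- unpack the checker
  simp only [check, Bool.and_eq_true, decide_eq_true_eq, List.all_eq_true] at hchk
  obtain ⟨⟨⟨hbox, hent⟩, hposB⟩, hctrl⟩ := hchk
  obtain ⟨hD, hP01, hP1D, hU01, hU1D, hV01, hV1D⟩ := hbox
  have hDpos : (0 : ℝ) < d.D := by exact_mod_cast hD
  have hDp : (0 : ℝ) < d.D * p := mul_pos hDpos hp
  have hp1 : p ≤ 1 := by
    have h : (d.D : ℝ) * p ≤ d.D := hP1.trans (by exact_mod_cast hP1D)
    nlinarith
  have hr11 : r₁ ≤ 1 := by linarith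
  have hr21 : r₂ ≤ 1 := hr2.le
  have hr20 : 0 ≤ r₂ := hr10.trans hr12
  have hw1 : 0 < 1 - r₁ := by linarith
  have hw2 : 0 < 1 - r₂ := by linarith
  -- the window
  set nS : ℝ := if d.sfree then nn else ((d.SS : ℝ) + d.SS1 * p) / (d.D * p) with hnS
  set nE : ℝ := if d.efree then nn else ((d.SE : ℝ) + d.SE1 * p) / (d.D * p) with hnE
  have hSle : nS ≤ nn := by
    rw [hnS]; split_ifs with h
    · exact le_rfl
    · rcases hwS with h' | h'
      · exact absurd h' h
      · rw [div_le_iff₀ hDp]; linarith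
  have hEge : nn ≤ nE := by
    rw [hnE]; split_ifs with h
    · exact le_rfl
    · rcases hwE with h' | h'
      · exact absurd h' h
      · rw [le_div_iff₀ hDp]; linarith
  have hent' : ∀ e ∈ d.entries, entryOk d e = true := hent
  have hS : ∀ e ∈ d.entries, e.kind = 3 → nS * ((d.D : ℝ) * p) = d.SS + d.SS1 * p := by
    intro e he h3
    have hok := hent e he
    simp only [entryOk, Bool.and_eq_true, Bool.or_eq_true, decide_eq_true_eq] at hok
    obtain ⟨⟨-, hsf⟩, -⟩ := hok
    have hns : d.sfree = false := by
      cases hh : d.sfree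
      · rfl
      · exact absurd h3 (hsf hh)
    rw [hnS, hns]; simp only [Bool.false_eq_true, if_false]
    field_simp
  have hE : ∀ e ∈ d.entries, e.kind = 4 → nE * ((d.D : ℝ) * p) = d.SE + d.SE1 * p := by
    intro e he h4
    have hok := hent e he
    simp only [entryOk, Bool.and_eq_true, Bool.or_eq_true, decide_eq_true_eq] at hok
    obtain ⟨-, hef⟩ := hok
    have hne : d.efree = false := by
      cases hh : d.efree
      · rfl
      · exact absurd h4 (hef hh)
    rw [hnE, hne]; simp only [Bool.false_eq_true, if_false]
    field_simp
  apply Gate3.red8_of_red8i p r₁ r₂ nS nE nn hp.le hr10 hr11 hr20 hr21 hSle hEge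
  apply cert8u p r₁ r₂ nS nE hp.le hp1 hr10 hr11 hr20 hr21 (lamL d.entries p r₁ r₂) (nuL d.entries p r₁ r₂)
    (lamL_nonneg d.entries p r₁ r₂ hp.le hr11 hr21) (nuL_nonneg d.entries p r₁ r₂ hp.le hr11 hr21)
  · -- positivity
    simp only [posOk, List.any_eq_true, decide_eq_true_eq] at hposB
    obtain ⟨e, he, hk4, hidx, hmu⟩ := hposB
    have hwt : 0 < wt e p r₁ r₂ := by
      unfold wt sfac
      have := mval_pos e.mono p (1 - r₁) (1 - r₂) hp hw1 hw2
      have hmu' : (0 : ℝ) < e.mu := by exact_mod_cast hmu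
      split_ifs <;> positivity
    have hnn := lamL_nonneg d.entries p r₁ r₂ hp.le hr11 hr21
    have key : ∀ (i : Fin 5) (x : Fin 8), e.kind = i.val → e.idx = x.val → wt e p r₁ r₂ ≤ lamL d.entries p r₁ r₂ i x := by
      intro i x hi hx
      unfold lamL
      have hmem : wt e p r₁ r₂ ∈ (d.entries.map fun e' => if e'.kind = i.val ∧ e'.idx = x.val then wt e' p r₁ r₂ else 0) := by
        rw [List.mem_map]; exact ⟨e, he, by rw [if_pos ⟨hi, hx⟩]⟩
      apply List.single_le_sum _ _ hmem
      intro y hy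
      rw [List.mem_map] at hy
      obtain ⟨e', -, rfl⟩ := hy
      split_ifs
      · exact wt_nonneg e' p r₁ r₂ hp.le hr11 hr21
      · exact le_rfl
    have h03 := hnn 0 3; have h13 := hnn 1 3; have h23 := hnn 2 3; have h33 := hnn 3 3; have h43 := hnn 4 3
    have h04 := hnn 0 4; have h14 := hnn 1 4; have h24 := hnn 2 4; have h34 := hnn 3 4; have h44 := hnn 4 4
    interval_cases hk : e.kind <;> rcases hidx with hx | hx
    all_goals first
      | (have := key 0 3 rfl hx; linarith) | (have := key 0 4 rfl hx; linarith)
      | (have := key 1 3 rfl hx; linarith) | (have := key 1 4 rfl hx; linarith)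
      | (have := key 2 3 rfl hx; linarith) | (have := key 2 4 rfl hx; linarith)
      | (have := key 3 3 rfl hx; linarith) | (have := key 3 4 rfl hx; linarith)
      | (have := key 4 3 rfl hx; linarith) | (have := key 4 4 rfl hx; linarith)
  · -- the 36 conditions
    intro c c' hle
    have hge : c.val ≤ c'.val := hle
    · have hcc := hctrl c (List.mem_finRange c) c' (List.mem_finRange c')
      simp only [Bool.or_eq_true, decide_eq_true_eq] at hcc
      rcases hcc with hbad | hnp
      · exact absurd hbad (not_lt.2 hge)
      · rw [V27.nonpos_iff, V27.toP2_ctrl, toP2_polyOfV d c c' (fun e he => (entry_facts d e (hent' e he)).1)] at hnp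
        have hreal := nonpos_map_int _ hnp
        rw [map_ctrl] at hreal
        have hev := eval_nonpos_of_ctrl ((d.P0 : ℤ) : ℝ) ((d.P1 : ℤ) : ℝ) ((d.U0 : ℤ) : ℝ) ((d.U1 : ℤ) : ℝ) ((d.V0 : ℤ) : ℝ) ((d.V1 : ℤ) : ℝ) ((d.D : ℤ) : ℝ)
          (map (Int.castRingHom ℝ) (polyOf d c c')) p (1 - r₁) (1 - r₂) (by exact_mod_cast hD)
          (by push_cast; linarith) (by push_cast; linarith) (by push_cast; linarith) (by push_cast; linarith) (by push_cast; linarith) (by push_cast; linarith)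
          (by simpa only [eq_intCast] using hreal)
        rw [eval_polyOf d hent' c c' p r₁ r₂ nS nE hr12 hS hE] at hev
        by_contra hh
        push Not at hh
        have := mul_pos hDpos hh
        linarith

end BoxCert

end Quant

end Summit.CriticalPhenomena.PercolationContinuityZ3.Theorems
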